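import Summits.ResolutionOfSingularities.ResolutionOfSingularities.Theorems.FrobeniusClosingSteerNonRationalStepLocalBezout
import Literature.AlgebraicGeometry.Resolution.WeakJacobianDerivations
import Mathlib.RingTheory.Kaehler.Basic
import Mathlib.Algebra.MvPolynomial.PDeriv
import Mathlib.LinearAlgebra.Basis.VectorSpace
import Mathlib.Algebra.CharP.Two
import Mathlib.RingTheory.MvPolynomial.Basic
import HarnessLib

/-!
# Crux `Steer` (stmt-ResolutionOfSingularities-16345), chain W4.1 — K-I2 FILE B: **THE KEY DERIVATION LEMMA in `M = K[T,U]`**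
# (`derivation_apply_mem_pow`, `derivation_apply_mem_map_of_clean`)

OURS (campaign `res-hironaka`, rung L ★L-G4, slot W4.1; the I″ kernel `LemmaI.NonRationalStepNotIsolated` by derivations + local Bezout,
res-L0-w41-idea-3 blueprint `K-I2-BLUEPRINT.md` ae0581fa150ab9c1 / signatures `K-I2_signatures.lean` e62c805738af0a97 §FILE B, statements
VERBATIM; seat res-L0-w41-idea-3 g12 on res-L0-w41-plan-1 RULING 274 (a)). Candidates, not facts; nothing here is a statement of
H. Hironakaʼs manuscript [Hironaka2017] (status: under review). AI-written; AI review is weaker than expert review. Theses-free, definition-free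
commutative algebra over an arbitrary field `K` of characteristic `2`.

Let `M = K[X₀,X₁]`, `𝔫 ⊂ M` maximal, and suppose `s²·P − a² ∈ 𝔫^d` with `s ∉ 𝔫` (a CLEAN READING of `P` of order `d`).
* (B1) `derivation_apply_mem_pow` — ORDER DROP: `Δ P ∈ 𝔫^(d-1)` for every derivation `Δ` of `M` (characteristic `2` kills `Δ(s²)` and `Δ(a²)`;
  `Δ(𝔫^d) ⊆ 𝔫^(d-1)`; `𝔫^(d-1)` is `𝔫`-primary).
* (B2) `derivation_apply_mem_map_of_clean` — THE KEY LEMMA: if moreover `deg P ≤ d` and a prime `𝔭 ≤ 𝔫` contains some `h ≠ 0` with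
  `deg h · d < (d−1)·[M⧸𝔫 : K]`, then `δ P ∈ 𝔭·N` for every ring map `ε : M → N` and every derivation `δ` of `M` ALONG `ε` (bare function,
  additive, Leibniz `δ(xy) = ε x · δ y + ε y · δ x`). Proof: `δ = Σ_j φ(ω_j)·(ε ∘ Δ_j) + Σ_i δ(X_i)·(ε ∘ ∂_i)` ON `P`, where `ω_j` runs over a
  `K`-basis of the absolute Kähler module `Ω_{K/ℤ}`, `Δ_j` is the coefficientwise extension of the coordinate derivation `ω_j^* ∘ d : K → K`
  (`MvPolynomial.exists_derivation_C_eq_X_eq`), `φ : Ω_{K/ℤ} → N` is the lift of `δ ∘ C` (`Derivation.liftKaehlerDifferential`) and the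
  identity of the two sides on `P` is `MvPolynomial.derivation_apply_eq_of_eqOn`; each `Δ_j P`, `∂_i P` lies in `𝔫^(d-1)` by (B1), has degree
  `≤ d`, hence lies in `𝔭` by FILE A (A2) `mem_of_mem_pow_of_totalDegree_le` (local Bezout).
[cite: Matsumura1987, §25 p. 190, §26 Thm. 26.5, Thm. 30.5 (2) p. 234] [cite: Kunz2005PlaneAlgebraicCurves, App. A] [folklore]
-/

noncomputable section

set_option linter.dupNamespace false

open IsLocalRing Module MvPolynomial

namespace Summit.ResolutionOfSingularities.ResolutionOfSingularities.Theorems.SwitchingDichotomy.LemmaI2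

open Literature.AlgebraicGeometry.Resolution

variable {K : Type} [Field K]

/-! ## §0 Derivation calculus -/

/-- ORDER DROP for derivations: `Δ(I^(k+1)) ⊆ I^k`. [cite: Matsumura1987, §25 p. 190] [folklore] -/
theorem derivation_apply_mem_pow_of_mem_pow_succ {R : Type*} [CommRing R] (I : Ideal R) (Δ : Derivation ℤ R R) :
    ∀ (k : ℕ) {x : R}, x ∈ I ^ (k + 1) → Δ x ∈ I ^ k := by
  intro k
  induction k with
  | zero => intro x _; simp
  | succ k ih =>
    intro x hx
    rw [pow_succ'] at hx
    refine Submodule.mul_induction_on hx (fun m hm n hn => ?_) (fun x y hx hy => ?_)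
    · rw [Derivation.leibniz, smul_eq_mul, smul_eq_mul, pow_succ']
      exact add_mem (Ideal.mul_mem_mul hm (ih hn)) (by rw [← pow_succ']; exact Ideal.mul_mem_right _ _ hn)
    · rw [map_add]; exact add_mem hx hy

/-- In characteristic `2` every derivation kills squares: `Δ(a²) = 2aΔ(a) = 0`. [folklore] -/
theorem derivation_apply_sq {R : Type*} [CommRing R] [CharP R 2] (Δ : Derivation ℤ R R) (a : R) : Δ (a ^ 2) = 0 := by
  rw [pow_two, Derivation.leibniz, smul_eq_mul]
  exact CharTwo.add_self_eq_zero _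

/-- Values of a finite sum of derivations. [folklore] -/
theorem derivation_finset_sum_apply {ι R A N : Type*} [CommRing R] [CommRing A] [Algebra R A] [AddCommGroup N] [Module A N]
    [Module R N] (s : Finset ι) (f : ι → Derivation R A N) (a : A) : (∑ i ∈ s, f i) a = ∑ i ∈ s, f i a := by
  induction s using Finset.cons_induction with
  | empty => simp
  | cons j s hj ih => rw [Finset.sum_cons, Finset.sum_cons, Derivation.add_apply, ih]

/-- `deg ∂_i P ≤ deg P`. [folklore] -/
theorem totalDegree_pderiv_le {σ : Type*} (i : σ) (P : MvPolynomial σ K) : (pderiv i P).totalDegree ≤ P.totalDegree := by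
  classical
  conv_lhs => rw [P.as_sum]
  rw [map_sum]
  refine totalDegree_finsetSum_le fun v hv => ?_
  rw [pderiv_monomial]
  refine (totalDegree_monomial_le _ _).trans (le_trans ?_ (le_totalDegree hv))
  have hle : v - Finsupp.single i 1 ≤ v := tsub_le_self
  have := Finsupp.degree_mono hle
  simpa [Finsupp.degree_apply, Finsupp.sum] using this

/-- A COEFFICIENTWISE derivation (`Δ(C c) = C(δ c)`, `Δ(X_i) = 0`) does not raise the degree. [folklore] -/
theorem totalDegree_coeffDerivation_le {σ : Type*} {δ : Derivation ℤ K K}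
    {Δ : Derivation ℤ (MvPolynomial σ K) (MvPolynomial σ K)} (hC : ∀ c, Δ (C c) = C (δ c)) (hX : ∀ i, Δ (X i) = 0)
    (P : MvPolynomial σ K) : (Δ P).totalDegree ≤ P.totalDegree := by
  classical
  conv_lhs => rw [P.as_sum]
  rw [map_sum]
  refine totalDegree_finsetSum_le fun v hv => ?_
  have hmono : monomial v (coeff v P) = C (coeff v P) * monomial v 1 := by rw [C_mul_monomial, mul_one]
  rw [hmono, Derivation.leibniz, MvPolynomial.derivation_monomial_one_eq_zero Δ hX, smul_zero, zero_add, smul_eq_mul, hC,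
    mul_comm, C_mul_monomial, mul_one]
  exact (totalDegree_monomial_le _ _).trans (le_totalDegree hv)

/-- Coefficientwise extension of a derivation of `K` to `K[X_σ]` killing the variables (`MvPolynomial.exists_derivation_C_eq_X_eq`).
[cite: Matsumura1987, Thm. 30.5 (2) p. 234] -/
theorem exists_coeffDerivation' {σ : Type*} (δ : Derivation ℤ K K) :
    ∃ Δ : Derivation ℤ (MvPolynomial σ K) (MvPolynomial σ K), (∀ c, Δ (C c) = C (δ c)) ∧ ∀ i, Δ (X i) = 0 := by
  obtain ⟨Δ, hC, hX⟩ := MvPolynomial.exists_derivation_C_eq_X_eq (σ := σ) (T := MvPolynomial σ K)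
    ((Algebra.linearMap K (MvPolynomial σ K)).compDer δ) (fun _ => (0 : MvPolynomial σ K))
  refine ⟨Δ, fun c => ?_, hX⟩
  rw [hC]
  change Algebra.linearMap K (MvPolynomial σ K) (δ c) = C (δ c)
  rw [Algebra.linearMap_apply, MvPolynomial.algebraMap_eq]

/-! ## §1 (B1) the order drop under a clean reading -/

section FileB

variable [CharP K 2]

/-- (B1) = (S3): ORDER DROP. If `s²·P − a² ∈ 𝔫^d` with `s ∉ 𝔫` then `Δ P ∈ 𝔫^(d-1)` for every derivation `Δ` of `M` (characteristic 2:
`Δ(s² P − a²) = s² Δ P`; `Δ(𝔫^d) ⊆ 𝔫^(d-1)`; `𝔫^(d-1)` is `𝔫`-primary). [cite: Matsumura1987, §25 p. 190] [folklore] -/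
theorem derivation_apply_mem_pow (𝔫 : Ideal (MvPolynomial (Fin 2) K)) [𝔫.IsMaximal] {P s a : MvPolynomial (Fin 2) K} {d : ℕ}
    (hs : s ∉ 𝔫) (hclean : s ^ 2 * P - a ^ 2 ∈ 𝔫 ^ d) (Δ : Derivation ℤ (MvPolynomial (Fin 2) K) (MvPolynomial (Fin 2) K)) :
    Δ P ∈ 𝔫 ^ (d - 1) := by
  rcases d with _ | k
  · simp
  · have ha : Δ (a ^ 2) = 0 := derivation_apply_sq Δ a
    have hs2 : Δ (s ^ 2) = 0 := derivation_apply_sq Δ s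
    have h1 : Δ (s ^ 2 * P - a ^ 2) = s ^ 2 * Δ P := by
      rw [map_sub, Derivation.leibniz, ha, hs2, smul_zero, add_zero, sub_zero, smul_eq_mul]
    have h2 : s ^ 2 * Δ P ∈ 𝔫 ^ k := by
      rw [← h1]; exact derivation_apply_mem_pow_of_mem_pow_succ 𝔫 Δ k hclean
    rcases Ideal.IsMaximal.mul_mem_pow 𝔫 h2 with h | h
    · exact absurd (‹𝔫.IsMaximal›.isPrime.mem_of_pow_mem 2 h) hs
    · simpa using h

/-! ## §2 (B2) the key lemma: derivations along a map -/

/-- (B2) **(KEY′)**: `deg P ≤ d`, `s² P − a² ∈ 𝔫^d` (`s ∉ 𝔫`), a prime `𝔭 ≤ 𝔫` containing some `h ≠ 0` of degree `≤ δ'`, `δ'·d < (d−1)·[M/𝔫 : K]`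
⇒ for every ring map `ε : M →+* N` and every derivation `δ` of `M` ALONG `ε`, `δ P ∈ 𝔭·N`. (Split `δ` on coefficients and variables with
`MvPolynomial.exists_derivation_C_eq_X_eq` / `derivation_apply_eq_of_eqOn`: `δ P = Σ_j ε(P_j)·g(ω_j) + δ(T)·ε(∂_T P) + δ(U)·ε(∂_U P)` over a basis
`ω_j` of `Ω_{K/ℤ}`, `P_j := (coord_j ∘ d)^c P`; each `P_j`, `∂_T P`, `∂_U P` lies in `𝔫^(d-1)` by (B1) and has degree `≤ d`, so FILE A (A2) puts
each in `𝔭`.) [cite: Matsumura1987, §26, Thm. 30.5] [folklore] -/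
theorem derivation_apply_mem_map_of_clean (𝔫 : Ideal (MvPolynomial (Fin 2) K)) [𝔫.IsMaximal]
    (𝔭 : Ideal (MvPolynomial (Fin 2) K)) [𝔭.IsPrime] (h𝔭𝔫 : 𝔭 ≤ 𝔫)
    {P s a h : MvPolynomial (Fin 2) K} {d δ' : ℕ} (hP : P.totalDegree ≤ d) (hs : s ∉ 𝔫)
    (hclean : s ^ 2 * P - a ^ 2 ∈ 𝔫 ^ d) (hh : h ∈ 𝔭) (hh0 : h ≠ 0) (hdeg : h.totalDegree ≤ δ')
    (hineq : δ' * d < (d - 1) * finrank K (MvPolynomial (Fin 2) K ⧸ 𝔫))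
    {N : Type} [CommRing N] (ε : MvPolynomial (Fin 2) K →+* N) (δ : MvPolynomial (Fin 2) K → N)
    (hadd : ∀ x y, δ (x + y) = δ x + δ y) (hmul : ∀ x y, δ (x * y) = ε x * δ y + ε y * δ x) :
    δ P ∈ Ideal.map ε 𝔭 := by
  classical
  -- the membership engine: (B1) + FILE A (A2)
  have hA2 : ∀ Ψ : MvPolynomial (Fin 2) K, Ψ ∈ 𝔫 ^ (d - 1) → Ψ.totalDegree ≤ d → Ψ ∈ 𝔭 := fun Ψ hΨ hdegΨ =>
    mem_of_mem_pow_of_totalDegree_le 𝔫 𝔭 h𝔭𝔫 hh hh0 hdeg hΨ hdegΨ hineq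
  have hmap : ∀ Ψ : MvPolynomial (Fin 2) K, Ψ ∈ 𝔭 → ∀ n : N, ε Ψ * n ∈ Ideal.map ε 𝔭 := fun Ψ hΨ n =>
    Ideal.mul_mem_right n _ (Ideal.mem_map_of_mem ε hΨ)
  -- `N` as an algebra over `M = K[X₀,X₁]` and over `K` through `ε`
  letI algMN : Algebra (MvPolynomial (Fin 2) K) N := ε.toAlgebra
  letI algKN : Algebra K N := (ε.comp (algebraMap K (MvPolynomial (Fin 2) K))).toAlgebra
  haveI : IsScalarTower K (MvPolynomial (Fin 2) K) N := IsScalarTower.of_algebraMap_eq (fun _ => rfl)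
  have hsmulM : ∀ (q : MvPolynomial (Fin 2) K) (n : N), q • n = ε q * n := fun q n => Algebra.smul_def q n
  have hsmulK : ∀ (c : K) (n : N), c • n = ε (C c) * n := fun c n => Algebra.smul_def c n
  -- `δ` as a derivation `D : M → N` over `ℤ`
  let D : Derivation ℤ (MvPolynomial (Fin 2) K) N :=
    Derivation.mk' (AddMonoidHom.mk' δ hadd).toIntLinearMap fun x y => by
      change δ (x * y) = x • δ y + y • δ x
      rw [hmul, hsmulM, hsmulM]
  have hD : ∀ x, D x = δ x := fun x => rfl
  -- (i) the VARIABLE part: `∂_i P ∈ 𝔭`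
  have hpd : ∀ i : Fin 2, pderiv i P ∈ 𝔭 := fun i =>
    hA2 _ (derivation_apply_mem_pow 𝔫 hs hclean ((pderiv i).restrictScalars ℤ)) ((totalDegree_pderiv_le i P).trans hP)
  -- (ii) the COEFFICIENT part: coordinate derivations of `K` from a basis of `Ω_{K/ℤ}`
  let b := Basis.ofVectorSpace K (KaehlerDifferential ℤ K)
  let Dj : Basis.ofVectorSpaceIndex K (KaehlerDifferential ℤ K) → Derivation ℤ K K := fun j =>
    (b.coord j).compDer (KaehlerDifferential.D ℤ K)
  have hDj : ∀ j c, Dj j c = b.repr (KaehlerDifferential.D ℤ K c) j := fun j c => rfl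
  have hΔex : ∀ j, ∃ Δ : Derivation ℤ (MvPolynomial (Fin 2) K) (MvPolynomial (Fin 2) K),
      (∀ c, Δ (C c) = C (Dj j c)) ∧ ∀ i, Δ (X i) = 0 := fun j => exists_coeffDerivation' (Dj j)
  choose Δ hΔC hΔX using hΔex
  have hΔmem : ∀ j, Δ j P ∈ 𝔭 := fun j =>
    hA2 _ (derivation_apply_mem_pow 𝔫 hs hclean (Δ j)) ((totalDegree_coeffDerivation_le (hΔC j) (hΔX j) P).trans hP)
  -- the lift `φ : Ω_{K/ℤ} → N` of `δ ∘ C`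
  let δK : Derivation ℤ K N := D.compAlgebraMap K
  let φ : KaehlerDifferential ℤ K →ₗ[K] N := δK.liftKaehlerDifferential
  have hφ : ∀ c, φ (KaehlerDifferential.D ℤ K c) = δ (C c) := fun c => by
    rw [Derivation.liftKaehlerDifferential_comp_D]; rfl
  -- the finite set of basis indices met by the coefficients of `P`
  let J : Finset (Basis.ofVectorSpaceIndex K (KaehlerDifferential ℤ K)) :=
    P.coeffs.biUnion fun c => (b.repr (KaehlerDifferential.D ℤ K c)).support
  have hJ : ∀ c ∈ P.coeffs, (b.repr (KaehlerDifferential.D ℤ K c)).support ⊆ J := fun c hc =>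
    Finset.subset_biUnion_of_mem (fun c => (b.repr (KaehlerDifferential.D ℤ K c)).support) hc
  -- the comparison derivation `Dtot = Σ_j φ(ω_j)·Δ_j + Σ_i δ(X_i)·∂_i`
  let E : Basis.ofVectorSpaceIndex K (KaehlerDifferential ℤ K) → Derivation ℤ (MvPolynomial (Fin 2) K) N := fun j =>
    (LinearMap.toSpanSingleton (MvPolynomial (Fin 2) K) N (φ (b j))).compDer (Δ j)
  let V : Fin 2 → Derivation ℤ (MvPolynomial (Fin 2) K) N := fun i =>
    (LinearMap.toSpanSingleton (MvPolynomial (Fin 2) K) N (δ (X i))).compDer ((pderiv i).restrictScalars ℤ)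
  have hE : ∀ j Q, E j Q = ε (Δ j Q) * φ (b j) := fun j Q => by
    change (LinearMap.toSpanSingleton (MvPolynomial (Fin 2) K) N (φ (b j))) (Δ j Q) = _
    rw [LinearMap.toSpanSingleton_apply, hsmulM]
  have hV : ∀ i Q, V i Q = ε (pderiv i Q) * δ (X i) := fun i Q => by
    change (LinearMap.toSpanSingleton (MvPolynomial (Fin 2) K) N (δ (X i))) (pderiv i Q) = _
    rw [LinearMap.toSpanSingleton_apply, hsmulM]
  let Dtot : Derivation ℤ (MvPolynomial (Fin 2) K) N := (∑ j ∈ J, E j) + ∑ i, V i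
  have hDtot : ∀ Q, Dtot Q = (∑ j ∈ J, ε (Δ j Q) * φ (b j)) + ∑ i, ε (pderiv i Q) * δ (X i) := fun Q => by
    change ((∑ j ∈ J, E j) + ∑ i, V i) Q = _
    rw [Derivation.add_apply, derivation_finset_sum_apply, derivation_finset_sum_apply]
    simp_rw [hE, hV]
  -- `D` and `Dtot` agree on the coefficients of `P` and on the variables, hence on `P`
  have hagree : D P = Dtot P := by
    refine MvPolynomial.derivation_apply_eq_of_eqOn D Dtot P (fun c hc => ?_) (fun i => ?_)
    · rw [hD, hDtot]
      simp_rw [pderiv_C, map_zero, zero_mul, Finset.sum_const_zero, add_zero, hΔC]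
      rw [← hφ c]
      conv_lhs => rw [← b.linearCombination_repr (KaehlerDifferential.D ℤ K c), Finsupp.linearCombination_apply, Finsupp.sum,
        map_sum]
      rw [Finset.sum_subset (hJ c hc) (fun j _ hj => by rw [Finsupp.notMem_support_iff.mp hj, zero_smul, map_zero])]
      refine Finset.sum_congr rfl fun j _ => ?_
      rw [map_smul, hsmulK, hDj]
    · rw [hD, hDtot]
      simp_rw [hΔX, map_zero, zero_mul, Finset.sum_const_zero, zero_add, pderiv_X]
      rw [Fin.sum_univ_two]
      fin_cases i <;> simp
  -- conclusion
  rw [← hD, hagree, hDtot]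
  exact add_mem (sum_mem fun j _ => hmap _ (hΔmem j) _) (sum_mem fun i _ => hmap _ (hpd i) _)

end FileB

end Summit.ResolutionOfSingularities.ResolutionOfSingularities.Theorems.SwitchingDichotomy.LemmaI2

end
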